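import Summits.CriticalPhenomena.PercolationContinuityZ3.Theorems.PercNearOneGluingNoHeavyQuantFarGate3PinchWAllS10
import Summits.CriticalPhenomena.PercolationContinuityZ3.Theorems.PercNearOneGluingNoHeavyQuantFarGate3PinchWAllS9
import HarnessLib

/-!
# QUANT lane R8, front "FAR beyond trees", layer one — THE DEGREE-THREE GATE AT THE OBSERVER: pinch chart W — MASTER theorem `pinchW_all`

builds on p205010 (kernel theorem, internal audit signed; external expert review pending)

Support file (`--supports stmt-CriticalPhenomena-4575`), seats `prim-quant-p1` gen 35/36; memos
`run/shared/lean/prim/quant/prim-quant-p1-g35/FOR-LEAD-GATE3-PINCH.md`, `…/prim-quant-p1-g36/FOR-LEAD-GATE3-PINCH2.md`.  Data files / sub-masters of chart W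
only; standard axioms; no sorries.  GENERATED by `dataN2/gen_master3.py`.
`pinchW_all`: chart W (`PinchW.spec`) has no bad point on the whole box `y ∈ [0, 3/16]`, `a ∈ [0, 1]`, `b ∈ [0, 1]`, `c ∈ [-3, 3]`
(93 kernel-checked certificates in 86 data files), by dispatch along the k-d tree of the file regions (via 10 sub-masters) — the hypothesis `HW`
of the pinch atlas `Gate3.chartC_of_pinchAtlas` (file LXXII).
[this work].
-/

namespace Summit.CriticalPhenomena.PercolationContinuityZ3.Theorems

namespace Quant

set_option maxHeartbeats 800000 in
/-- Chart W has no bad point on its whole atlas box. [this work] -/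
theorem pinchW_all : CertN.BoxOKR PinchW.spec (0 : ℝ) ((3 : ℝ) / 16) (0 : ℝ) (1 : ℝ) (0 : ℝ) (1 : ℝ) (-3 : ℝ) (3 : ℝ) := by
  intro y a b c hylo hyhi halo hahi hblo hbhi hclo hchi v
  rcases le_total y ((1 : ℝ) / 8) with hcut | hcut
  · exact pinchW_all_s9 y a b c (by linarith) (by linarith) (by linarith) (by linarith) (by linarith) (by linarith) (by linarith) (by linarith) v
  · exact pinchW_all_s10 y a b c (by linarith) (by linarith) (by linarith) (by linarith) (by linarith) (by linarith) (by linarith) (by linarith) v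

end Quant

end Summit.CriticalPhenomena.PercolationContinuityZ3.Theorems
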